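import Summits.QuantumFields.BalabanUV.Beta.FP.NearRegionCrossBubblePoint

/-!
# `BalabanUV.Beta.FP.NearRegionCrossBubble` — road «FP» (binder row D1), organisation β of `RHOA-DESIGN.md` §3, row RHOA-3 (N-PC generic), PART 2a:
# THE NEAR-REGION WINDOW SUMS — `Σ_{0<‖z‖∞≤n} ‖z‖∞²·|bubble(F,R)(z)| ≤ K·B` n-FREE at the scale-n letters `B_j = B/n^{2+j}` of `R` (the EXACT powers `n⁻²·n²`,
# `n⁻³·n³`, `n⁻⁴·n⁴` of E-FP-5-2) ([folklore] lattice bookkeeping on `ℤ⁴`; no road object is typed or touched; the `(R′,R)` and tadpole twins are PART 2b)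

HONEST DEPENDENCY (page 1, mandatory): continuum YM on T⁴ ⇐ BetaPertH ∧ nine spine estimates (0/9 proved); BetaPertH ⇐ (D1) ∧ (D4) ∧
CAP+tail; G-an2-4 gates asym, D1 and NE2/3/4.  HONEST FRAMING (cell contract, verbatim): «discharging `BetaPertH` makes Bałaban's UV
stability UNCONDITIONAL — a real constructive-QFT result; it is NOT the continuum limit and NOT the Clay problem.»  THIS MODULE assembles BY NAME PART 1a∕1b∕1c
(`FP/NearRegionCrossBubble{Letters,Smear,Point}`) with the tree's `ℤ⁴` shell calculus (`WindowLog.shellSum`, `DyadicShell.sum_Ico_shellSum` ∕ `supNorm_eq_of_mem_sphere`,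
`TransferUV.card_annulus_succ_four_le`: `#{‖w‖∞ = r+1} ≤ 80(r+1)³`).  Every analytic input is a HYPOTHESIS displayed in the signatures; the module cites nothing, defines
nothing, mints no `Prop` fact, 0 sorry.  NOT the road's `R^Q`∕`R^g`∕`P^{BF}`∕`Ḣ` (RHOA-8 instantiates `F := P^{BF}`-entries, `R := R_n`-entries, `c₀, c₁ := Ḣ`-stencils),
NOT `ρ_n` bounded, NOT `hasym`, NOT D1, NOT BetaPertH, NOT continuum, NOT Clay.

ROW (road FP owner d1-p3-g6, `RHOA-DESIGN.md` 7feeae18441b23f4 §3 (N-PC) ∕ §5 RHOA-3, `LEAVES-FP.md` l.309; R-FP-22 (a)): «(N-PC) NEAR `‖z‖ ≤ n`: `|bubble(P,R_n)(z)| ≤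
C‖z‖⁻³·n⁻³`, `|bubble(R_n,R_n)(z)| ≤ Cn⁻⁶`, `|tadpole(R_n)(z)| ≤ …` ⟸ letters `|∇^jR_n| ≤ Cn^{−2−j}` + vertex letters ⟹ `Σ_{‖z‖≤n}|Π_n − K|(z)‖z‖² ≤ C(n⁻³·n³ + n⁻⁶·n⁶ + 1)
= O(1)`».  THE OBJECT `X(z) = Σ'_{q=((y,u),(w′,x′))} c₀ (y,u)·c₁ (w′,x′)·F(z+x′−y)·R u (z+w′)` (PART 1b; scalar fibre — fibres are finite sums, the consumer's).

CONTENT ([folklore]; `Θ_m := 2^{m+1}(m!e^{δ/2}(2/δ)^m)e^{δ/2}Zl(δ/2)²`, displayed at `m = a+2` with `a = 2` in the instantiated form `2^{2+2+1}((2+2)!…)`).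
* §1 `ℤ⁴` shell sums: `sum_annulus_le_of_shell_bound` (`Σ_{0<‖w‖∞≤n} g ≤ Σ_{r<n} 80(r+1)³·φ r` when `g ≤ φ r` on the shell `‖w‖∞ = r+1`), `sum_range_succ_pow_le`
  (`Σ_{r<n}(r+1)^k ≤ n^{k+1}`), `shell_weight_le` (`(r+1)³·(r+1)²/(r+2)^p ≤ (r+1)^k` for `k + p = 5`).
* §2 `abs_cross_le_point_two` (PART 1c's pointwise bound with the numerals evaluated at `a = 2` — for consumers with other windows, e.g. GAMMA-6) and
  **`sum_annulus_sq_mul_abs_cross_le` — THE NEAR-REGION CROSS TERM IS O(1)**: two localised ZERO-MASS weights (`C₀, C₁, δ`), `F` with the graded letters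
  `A₀∕(‖t‖∞+1)²`, `A₁∕(‖t‖∞+1)³`, `A₂∕(‖t‖∞+1)⁴`, `R` with the GLOBAL scale-`n` letters `|R| ≤ B/n²`, unit first differences (either argument) `≤ B/n³`, MIXED unit
  second differences `≤ B/n⁴` (`1 ≤ n`) ⟹
  `Σ_{z ∈ annulus 4 0 n} ‖z‖∞²·|X(z)| ≤ 80·((256A₂ + 256A₁ + 1297040A₀)·B)·(C₀Θ₄)(C₁Θ₄)` — n-FREE, `Θ₄ = 768·e^{δ/2}(2/δ)⁴e^{δ/2}Zl 4 (δ/2)²`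
  (= PART 1c's `(κ₂ + κ₁ + κ₀)·Θ_{a+2}²` at `a = 2`; the raw instantiated form is `sum_annulus_sq_mul_abs_cross_le'`).
* THE `(R′,R)` TWIN and THE TADPOLE TWIN are PART 2b `FP/NearRegionCrossBubbleTwins`.
Unit `b2b-balaban-gan24-formalise-leaf-05` (gen 36; cross-lane idle G-an2-4 swarm leaf seat on road FP), 2026-08-21; journal INTENT ∕ CLAIM «RHOA-3» l.23369.
-/

noncomputable section

namespace Summit.QuantumFields.BalabanUV.Beta.FP.NearRegionCrossBubble

open Finset Filter Topology fwdDiff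
open scoped BigOperators
open Literature.Probability.LatticeModels (annulus)
open Literature.MathematicalPhysics.QuantumFieldTheory.Balaban1983to89
open Literature.MathematicalPhysics.QuantumFieldTheory.Balaban1983to89.Beta
open B12Sec2to5 (l1 l1_nonneg)
open ExpKernelCalculus (Site Zl Zl_pos l1_sub_symm)
open WindowLog (shellSum)
open TransferUV (card_annulus_succ_four_le)
open DyadicShell (Pt supNorm supNorm_eq_zero_iff supNorm_eq_of_mem_sphere sum_Ico_shellSum)
open Summit.QuantumFields.BalabanUV.Beta.FP.ExpLocalisedBubble
open Summit.QuantumFields.BalabanUV.Beta.FP.ExpLocalisedBubblePoint (nonneg_of_decay_pow)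
open Summit.QuantumFields.BalabanUV.Beta.FP.NearRegionCrossBubbleLetters
open Summit.QuantumFields.BalabanUV.Beta.FP.NearRegionCrossBubbleSmear
open Summit.QuantumFields.BalabanUV.Beta.FP.NearRegionCrossBubblePoint

/-! ## §1 Shell sums on `ℤ⁴` -/

/-- [folklore] **WINDOW SUM FROM A SHELL BOUND**: if `g w ≤ φ r` on every shell `‖w‖∞ = r + 1` (`φ ≥ 0`), then
`Σ_{w ∈ annulus 4 0 n} g w ≤ Σ_{r<n} 80·(r+1)³·φ r` (`#shell ≤ 80(r+1)³`). -/
theorem sum_annulus_le_of_shell_bound {g : Pt → ℝ} {φ : ℕ → ℝ} (hφ : ∀ r, 0 ≤ φ r)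
    (hg : ∀ (r : ℕ) (w : Pt), w ∈ annulus 4 r (r + 1) → g w ≤ φ r) (n : ℕ) :
    ∑ w ∈ annulus 4 0 n, g w ≤ ∑ r ∈ Finset.range n, 80 * ((r : ℝ) + 1) ^ 3 * φ r := by
  rw [← sum_Ico_shellSum g (Nat.zero_le n), Finset.range_eq_Ico]
  refine Finset.sum_le_sum fun r _ => ?_
  rw [shellSum]
  calc ∑ w ∈ annulus 4 r (r + 1), g w ≤ ∑ w ∈ annulus 4 r (r + 1), φ r := Finset.sum_le_sum fun w hw => hg r w hw
    _ = ((annulus 4 r (r + 1)).card : ℝ) * φ r := by rw [Finset.sum_const, nsmul_eq_mul]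
    _ ≤ 80 * ((r : ℝ) + 1) ^ 3 * φ r := mul_le_mul_of_nonneg_right (card_annulus_succ_four_le r) (hφ r)

/-- [folklore] `Σ_{r<n} (r+1)^k ≤ n^{k+1}`. -/
theorem sum_range_succ_pow_le (n k : ℕ) : ∑ r ∈ Finset.range n, ((r : ℝ) + 1) ^ k ≤ (n : ℝ) ^ (k + 1) := by
  calc ∑ r ∈ Finset.range n, ((r : ℝ) + 1) ^ k ≤ ∑ _r ∈ Finset.range n, (n : ℝ) ^ k :=
        Finset.sum_le_sum fun r hr => by
          have h : (r : ℝ) + 1 ≤ n := by exact_mod_cast Finset.mem_range.mp hr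
          exact pow_le_pow_left₀ (by positivity) h k
    _ = (n : ℝ) * (n : ℝ) ^ k := by rw [Finset.sum_const, Finset.card_range, nsmul_eq_mul]
    _ = (n : ℝ) ^ (k + 1) := by ring

/-- [folklore] THE SHELL WEIGHT: `(r+1)³·((r+1)²/(r+1+1)^p) ≤ (r+1)^k` whenever `k + p = 5`. -/
theorem shell_weight_le (r : ℕ) {k p : ℕ} (hkp : k + p = 5) :
    ((r : ℝ) + 1) ^ 3 * (((r : ℝ) + 1) ^ 2 / ((r : ℝ) + 1 + 1) ^ p) ≤ ((r : ℝ) + 1) ^ k := by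
  have h1 : (0 : ℝ) < (r : ℝ) + 1 + 1 := by positivity
  rw [← mul_div_assoc, ← pow_add, div_le_iff₀ (by positivity), show 3 + 2 = k + p by omega, pow_add]
  exact mul_le_mul_of_nonneg_left (pow_le_pow_left₀ (by positivity) (by linarith) p) (by positivity)

/-! ## §2 The near-region window sum of the cross bubble at the scale-`n` letters -/

section Window

variable {c₀ c₁ : Pt × Pt → ℝ} {F : Pt → ℝ} {R : Pt → Pt → ℝ} {C₀ C₁ δ A₀ A₁ A₂ B : ℝ} {n : ℕ}

/-- [folklore] **THE POINTWISE CROSS-BUBBLE BOUND AT `a = 2`, CONSUMERS' FORM** (PART 1c's `abs_cross_le_point` with the numerals evaluated): letters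
`A₀/(‖t‖∞+1)²`, `A₁/(‖t‖∞+1)³`, `A₂/(‖t‖∞+1)⁴` of `F`, GLOBAL letters `B₀, B₁, B₂` of `R` (size ∕ unit first differences ∕ MIXED unit second differences), two ZERO-MASS weights ⟹
for EVERY `z`, `|X(z)| ≤ ((256A₂ + 1281024A₀)·B₀/(‖z‖∞+1)⁴ + (256A₁ + 16000A₀)·B₁/(‖z‖∞+1)³ + 16A₀·B₂/(‖z‖∞+1)²)·(C₀Θ₄)(C₁Θ₄)`, `Θ₄ = 768·e^{δ/2}(2/δ)⁴e^{δ/2}Zl 4 (δ/2)²`. -/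
theorem abs_cross_le_point_two {B₀ B₁ B₂ : ℝ} (hδ : 0 < δ)
    (hc₀ : ∀ p : Pt × Pt, |c₀ p| ≤ C₀ * (Real.exp (-δ * l1 p.1) * Real.exp (-δ * l1 p.2)))
    (hc₁ : ∀ p : Pt × Pt, |c₁ p| ≤ C₁ * (Real.exp (-δ * l1 p.1) * Real.exp (-δ * l1 p.2)))
    (h0 : ∑' p : Pt × Pt, c₀ p = 0) (h1 : ∑' p : Pt × Pt, c₁ p = 0)
    (hF0 : ∀ t : Pt, |F t| ≤ A₀ / ((supNorm t : ℝ) + 1) ^ 2)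
    (hF1 : ∀ (t : Pt) (i : Fin 4), |Δ_[(Pi.single i 1 : Pt)] F t| ≤ A₁ / ((supNorm t : ℝ) + 1) ^ 3)
    (hF2 : ∀ (t : Pt) (i j : Fin 4), |Δ_[(Pi.single i 1 : Pt)] (Δ_[(Pi.single j 1 : Pt)] F) t| ≤ A₂ / ((supNorm t : ℝ) + 1) ^ 4)
    (hR0 : ∀ u w, |R u w| ≤ B₀)
    (hR1 : ∀ (u w : Pt) (i : Fin 4), |R (u + Pi.single i 1) w - R u w| ≤ B₁)
    (hR1' : ∀ (u w : Pt) (j : Fin 4), |R u (w + Pi.single j 1) - R u w| ≤ B₁)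
    (hR2 : ∀ (u w : Pt) (i j : Fin 4),
      |R (u + Pi.single i 1) (w + Pi.single j 1) - R u (w + Pi.single j 1) - R (u + Pi.single i 1) w + R u w| ≤ B₂)
    (z : Pt) :
    |∑' q : (Pt × Pt) × (Pt × Pt), c₀ q.1 * c₁ q.2 * (F (z + q.2.2 - q.1.1) * R q.1.2 (z + q.2.1))|
      ≤ ((256 * A₂ + 1281024 * A₀) * B₀ / ((supNorm z : ℝ) + 1) ^ 4 + (256 * A₁ + 16000 * A₀) * B₁ / ((supNorm z : ℝ) + 1) ^ 3
          + 16 * A₀ * B₂ / ((supNorm z : ℝ) + 1) ^ 2)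
        * ((C₀ * (768 * Real.exp (δ / 2) * (2 / δ) ^ 4 * Real.exp (δ / 2) * Zl 4 (δ / 2) ^ 2))
          * (C₁ * (768 * Real.exp (δ / 2) * (2 / δ) ^ 4 * Real.exp (δ / 2) * Zl 4 (δ / 2) ^ 2))) := by
  have h := abs_cross_le_point (a := 2) hδ hc₀ hc₁ h0 h1 hF0 hF1 hF2 hR0 hR1 hR1' hR2 z
  have hf : (((2 + 2).factorial : ℕ) : ℝ) = 24 := by norm_num [Nat.factorial]
  rw [hf] at h
  refine h.trans (le_of_eq ?_)
  ring

/-- [folklore] THE NEAR-REGION CROSS TERM, RAW FORM (constants as PART 1c's `κ₂, κ₁, κ₀, Θ_{a+2}` instantiated at `a = 2`, exponents written `2+1`, `2+2`);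
the consumers' form is `sum_annulus_sq_mul_abs_cross_le` below. -/
theorem sum_annulus_sq_mul_abs_cross_le' (hδ : 0 < δ)
    (hc₀ : ∀ p : Pt × Pt, |c₀ p| ≤ C₀ * (Real.exp (-δ * l1 p.1) * Real.exp (-δ * l1 p.2)))
    (hc₁ : ∀ p : Pt × Pt, |c₁ p| ≤ C₁ * (Real.exp (-δ * l1 p.1) * Real.exp (-δ * l1 p.2)))
    (h0 : ∑' p : Pt × Pt, c₀ p = 0) (h1 : ∑' p : Pt × Pt, c₁ p = 0)
    (hF0 : ∀ t : Pt, |F t| ≤ A₀ / ((supNorm t : ℝ) + 1) ^ 2)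
    (hF1 : ∀ (t : Pt) (i : Fin 4), |Δ_[(Pi.single i 1 : Pt)] F t| ≤ A₁ / ((supNorm t : ℝ) + 1) ^ (2 + 1))
    (hF2 : ∀ (t : Pt) (i j : Fin 4), |Δ_[(Pi.single i 1 : Pt)] (Δ_[(Pi.single j 1 : Pt)] F) t| ≤ A₂ / ((supNorm t : ℝ) + 1) ^ (2 + 2))
    (hn : 1 ≤ n)
    (hR0 : ∀ u w, |R u w| ≤ B / (n : ℝ) ^ 2)
    (hR1 : ∀ (u w : Pt) (i : Fin 4), |R (u + Pi.single i 1) w - R u w| ≤ B / (n : ℝ) ^ 3)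
    (hR1' : ∀ (u w : Pt) (j : Fin 4), |R u (w + Pi.single j 1) - R u w| ≤ B / (n : ℝ) ^ 3)
    (hR2 : ∀ (u w : Pt) (i j : Fin 4),
      |R (u + Pi.single i 1) (w + Pi.single j 1) - R u (w + Pi.single j 1) - R (u + Pi.single i 1) w + R u w| ≤ B / (n : ℝ) ^ 4) :
    ∑ z ∈ annulus 4 0 n, (supNorm z : ℝ) ^ 2
        * |∑' q : (Pt × Pt) × (Pt × Pt), c₀ q.1 * c₁ q.2 * (F (z + q.2.2 - q.1.1) * R q.1.2 (z + q.2.1))|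
      ≤ 80 * (((16 * (2 ^ (2 + 2) * A₂) + 8 * 20 ^ (2 + 2) * A₀ + 4 * 4 ^ (2 + 2) * A₀)
              + (8 * (4 * (2 ^ (2 + 1) * A₁) + 2 * 10 ^ (2 + 1) * A₀)) + 16 * A₀) * B)
        * ((C₀ * (2 ^ (2 + 2 + 1) * (((2 + 2).factorial : ℝ) * Real.exp (δ / 2) * (2 / δ) ^ (2 + 2)) * Real.exp (δ / 2) * Zl 4 (δ / 2) ^ 2))
          * (C₁ * (2 ^ (2 + 2 + 1) * (((2 + 2).factorial : ℝ) * Real.exp (δ / 2) * (2 / δ) ^ (2 + 2)) * Real.exp (δ / 2) * Zl 4 (δ / 2) ^ 2))) := by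
  have hC₀ := nonneg_of_loc hc₀
  have hC₁ := nonneg_of_loc hc₁
  have hA0 := nonneg_of_decay_pow hF0
  have hA1 : 0 ≤ A₁ := nonneg_of_decay_pow (fun t => hF1 t 0)
  have hA2 : 0 ≤ A₂ := nonneg_of_decay_pow (fun t => hF2 t 0 0)
  have hnpos : (0 : ℝ) < n := by exact_mod_cast hn
  have hB : 0 ≤ B := by
    have h := (abs_nonneg _).trans (hR0 0 0)
    by_contra hneg
    push Not at hneg
    have : B / (n : ℝ) ^ 2 < 0 := div_neg_of_neg_of_pos hneg (pow_pos hnpos 2)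
    linarith
  have hZ : 0 < Zl 4 (δ / 2) := Zl_pos (half_pos hδ)
  -- abbreviations
  set Θ : ℝ := 2 ^ (2 + 2 + 1) * (((2 + 2).factorial : ℝ) * Real.exp (δ / 2) * (2 / δ) ^ (2 + 2)) * Real.exp (δ / 2) * Zl 4 (δ / 2) ^ 2 with hΘ
  set W : ℝ := (C₀ * Θ) * (C₁ * Θ) with hW
  have hW0 : 0 ≤ W := by positivity
  set κ₂ : ℝ := 16 * (2 ^ (2 + 2) * A₂) + 8 * 20 ^ (2 + 2) * A₀ + 4 * 4 ^ (2 + 2) * A₀ with hκ₂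
  set κ₁ : ℝ := 8 * (4 * (2 ^ (2 + 1) * A₁) + 2 * 10 ^ (2 + 1) * A₀) with hκ₁
  have hκ₂0 : 0 ≤ κ₂ := by positivity
  have hκ₁0 : 0 ≤ κ₁ := by positivity
  set P₀ : ℝ := κ₂ * (B / (n : ℝ) ^ 2) with hP₀
  set P₁ : ℝ := κ₁ * (B / (n : ℝ) ^ 3) with hP₁
  set P₂ : ℝ := 16 * A₀ * (B / (n : ℝ) ^ 4) with hP₂
  have hP₀0 : 0 ≤ P₀ := by positivity
  have hP₁0 : 0 ≤ P₁ := by positivity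
  have hP₂0 : 0 ≤ P₂ := by positivity
  show _ ≤ 80 * ((κ₂ + κ₁ + 16 * A₀) * B) * W
  -- the pointwise bound of PART 1c at `a = 2`
  have hpt : ∀ z : Pt, |∑' q : (Pt × Pt) × (Pt × Pt), c₀ q.1 * c₁ q.2 * (F (z + q.2.2 - q.1.1) * R q.1.2 (z + q.2.1))|
      ≤ (P₀ / ((supNorm z : ℝ) + 1) ^ (2 + 2) + P₁ / ((supNorm z : ℝ) + 1) ^ (2 + 1) + P₂ / ((supNorm z : ℝ) + 1) ^ 2) * W := by
    intro z
    have h := abs_cross_le_point (a := 2) hδ hc₀ hc₁ h0 h1 hF0 hF1 hF2 hR0 hR1 hR1' hR2 z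
    have e : (κ₂ * (B / (n : ℝ) ^ 2) / ((supNorm z : ℝ) + 1) ^ (2 + 2) + κ₁ * (B / (n : ℝ) ^ 3) / ((supNorm z : ℝ) + 1) ^ (2 + 1)
          + 16 * A₀ * (B / (n : ℝ) ^ 4) / ((supNorm z : ℝ) + 1) ^ 2) * ((C₀ * Θ) * (C₁ * Θ))
        = (P₀ / ((supNorm z : ℝ) + 1) ^ (2 + 2) + P₁ / ((supNorm z : ℝ) + 1) ^ (2 + 1) + P₂ / ((supNorm z : ℝ) + 1) ^ 2) * W := by
      rw [hP₀, hP₁, hP₂, hW]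
    rw [← e]
    exact h
  -- shell bound
  set φ : ℕ → ℝ := fun r => (((r : ℝ) + 1) ^ 2 * (P₀ / ((r : ℝ) + 1 + 1) ^ (2 + 2) + P₁ / ((r : ℝ) + 1 + 1) ^ (2 + 1) + P₂ / ((r : ℝ) + 1 + 1) ^ 2)) * W
    with hφ
  have hφ0 : ∀ r, 0 ≤ φ r := fun r => by rw [hφ]; positivity
  have hg : ∀ (r : ℕ) (w : Pt), w ∈ annulus 4 r (r + 1) →
      (supNorm w : ℝ) ^ 2 * |∑' q : (Pt × Pt) × (Pt × Pt), c₀ q.1 * c₁ q.2 * (F (w + q.2.2 - q.1.1) * R q.1.2 (w + q.2.1))| ≤ φ r := by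
    intro r w hw
    have hs : (supNorm w : ℝ) = (r : ℝ) + 1 := by rw [supNorm_eq_of_mem_sphere hw]; push_cast; ring
    have h := hpt w
    rw [hs] at h
    simp only [hφ]
    rw [hs]
    calc ((r : ℝ) + 1) ^ 2 * |∑' q : (Pt × Pt) × (Pt × Pt), c₀ q.1 * c₁ q.2 * (F (w + q.2.2 - q.1.1) * R q.1.2 (w + q.2.1))|
        ≤ ((r : ℝ) + 1) ^ 2 * ((P₀ / ((r : ℝ) + 1 + 1) ^ (2 + 2) + P₁ / ((r : ℝ) + 1 + 1) ^ (2 + 1) + P₂ / ((r : ℝ) + 1 + 1) ^ 2) * W) :=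
          mul_le_mul_of_nonneg_left h (by positivity)
      _ = _ := by ring
  have hsum := sum_annulus_le_of_shell_bound hφ0 hg n
  refine hsum.trans ?_
  -- `80(r+1)³·φ r ≤ 80·W·(P₀(r+1) + P₁(r+1)² + P₂(r+1)³)`
  have hterm : ∀ r : ℕ, 80 * ((r : ℝ) + 1) ^ 3 * φ r
      ≤ 80 * W * (P₀ * ((r : ℝ) + 1) ^ 1 + P₁ * ((r : ℝ) + 1) ^ 2 + P₂ * ((r : ℝ) + 1) ^ 3) := by
    intro r
    have w4 := shell_weight_le r (k := 1) (p := 2 + 2) (by norm_num)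
    have w3 := shell_weight_le r (k := 2) (p := 2 + 1) (by norm_num)
    have w2 := shell_weight_le r (k := 3) (p := 2) (by norm_num)
    have e : 80 * ((r : ℝ) + 1) ^ 3 * φ r
        = 80 * W * (P₀ * (((r : ℝ) + 1) ^ 3 * (((r : ℝ) + 1) ^ 2 / ((r : ℝ) + 1 + 1) ^ (2 + 2)))
            + P₁ * (((r : ℝ) + 1) ^ 3 * (((r : ℝ) + 1) ^ 2 / ((r : ℝ) + 1 + 1) ^ (2 + 1)))
            + P₂ * (((r : ℝ) + 1) ^ 3 * (((r : ℝ) + 1) ^ 2 / ((r : ℝ) + 1 + 1) ^ 2))) := by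
      rw [hφ]; ring
    rw [e]
    refine mul_le_mul_of_nonneg_left ?_ (by positivity)
    exact add_le_add (add_le_add (mul_le_mul_of_nonneg_left w4 hP₀0) (mul_le_mul_of_nonneg_left w3 hP₁0)) (mul_le_mul_of_nonneg_left w2 hP₂0)
  have hsum2 : ∑ r ∈ Finset.range n, 80 * ((r : ℝ) + 1) ^ 3 * φ r
      ≤ 80 * W * (P₀ * (n : ℝ) ^ (1 + 1) + P₁ * (n : ℝ) ^ (2 + 1) + P₂ * (n : ℝ) ^ (3 + 1)) := by
    calc ∑ r ∈ Finset.range n, 80 * ((r : ℝ) + 1) ^ 3 * φ r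
        ≤ ∑ r ∈ Finset.range n, 80 * W * (P₀ * ((r : ℝ) + 1) ^ 1 + P₁ * ((r : ℝ) + 1) ^ 2 + P₂ * ((r : ℝ) + 1) ^ 3) :=
          Finset.sum_le_sum fun r _ => hterm r
      _ = 80 * W * (P₀ * ∑ r ∈ Finset.range n, ((r : ℝ) + 1) ^ 1 + P₁ * ∑ r ∈ Finset.range n, ((r : ℝ) + 1) ^ 2
            + P₂ * ∑ r ∈ Finset.range n, ((r : ℝ) + 1) ^ 3) := by
          rw [← Finset.mul_sum, Finset.sum_add_distrib, Finset.sum_add_distrib, Finset.mul_sum, Finset.mul_sum, Finset.mul_sum]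
      _ ≤ 80 * W * (P₀ * (n : ℝ) ^ (1 + 1) + P₁ * (n : ℝ) ^ (2 + 1) + P₂ * (n : ℝ) ^ (3 + 1)) := by
          refine mul_le_mul_of_nonneg_left ?_ (by positivity)
          exact add_le_add (add_le_add (mul_le_mul_of_nonneg_left (sum_range_succ_pow_le n 1) hP₀0)
            (mul_le_mul_of_nonneg_left (sum_range_succ_pow_le n 2) hP₁0)) (mul_le_mul_of_nonneg_left (sum_range_succ_pow_le n 3) hP₂0)
  refine hsum2.trans (le_of_eq ?_)
  -- `P_j·n^{2+j} = κ_j·B`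
  have hn0 : (n : ℝ) ≠ 0 := hnpos.ne'
  rw [hP₀, hP₁, hP₂]
  field_simp
  ring

/-- [folklore] **THE NEAR-REGION CROSS TERM IS O(1), n-FREE** (E-FP-5-2's exact powers): two exponentially localised vertex weights with ZERO total mass,
a translation-invariant leg `F` with `|F t| ≤ A₀/(‖t‖∞+1)²`, `|Δ_iF t| ≤ A₁/(‖t‖∞+1)³`, `|Δ_iΔ_jF t| ≤ A₂/(‖t‖∞+1)⁴`, and a two-point leg `R` with the GLOBAL
scale-`n` letters `|R u w| ≤ B/n²`, unit first differences in either argument `≤ B/n³`, MIXED unit second differences `≤ B/n⁴` (`1 ≤ n`) ⟹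
`Σ_{z ∈ annulus 4 0 n} ‖z‖∞²·|X(z)| ≤ 80·((256A₂ + 256A₁ + 1297040A₀)·B)·(C₀Θ₄)(C₁Θ₄)`, `Θ₄ = 768·e^{δ/2}(2/δ)⁴e^{δ/2}Zl 4 (δ/2)²` — n-FREE.
The three channels are `n⁻²·Σ‖z‖²(‖z‖+1)⁻⁴ ≍ n⁻²·n²`, `n⁻³·n³`, `n⁻⁴·n⁴`. -/
theorem sum_annulus_sq_mul_abs_cross_le (hδ : 0 < δ)
    (hc₀ : ∀ p : Pt × Pt, |c₀ p| ≤ C₀ * (Real.exp (-δ * l1 p.1) * Real.exp (-δ * l1 p.2)))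
    (hc₁ : ∀ p : Pt × Pt, |c₁ p| ≤ C₁ * (Real.exp (-δ * l1 p.1) * Real.exp (-δ * l1 p.2)))
    (h0 : ∑' p : Pt × Pt, c₀ p = 0) (h1 : ∑' p : Pt × Pt, c₁ p = 0)
    (hF0 : ∀ t : Pt, |F t| ≤ A₀ / ((supNorm t : ℝ) + 1) ^ 2)
    (hF1 : ∀ (t : Pt) (i : Fin 4), |Δ_[(Pi.single i 1 : Pt)] F t| ≤ A₁ / ((supNorm t : ℝ) + 1) ^ 3)
    (hF2 : ∀ (t : Pt) (i j : Fin 4), |Δ_[(Pi.single i 1 : Pt)] (Δ_[(Pi.single j 1 : Pt)] F) t| ≤ A₂ / ((supNorm t : ℝ) + 1) ^ 4)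
    (hn : 1 ≤ n)
    (hR0 : ∀ u w, |R u w| ≤ B / (n : ℝ) ^ 2)
    (hR1 : ∀ (u w : Pt) (i : Fin 4), |R (u + Pi.single i 1) w - R u w| ≤ B / (n : ℝ) ^ 3)
    (hR1' : ∀ (u w : Pt) (j : Fin 4), |R u (w + Pi.single j 1) - R u w| ≤ B / (n : ℝ) ^ 3)
    (hR2 : ∀ (u w : Pt) (i j : Fin 4),
      |R (u + Pi.single i 1) (w + Pi.single j 1) - R u (w + Pi.single j 1) - R (u + Pi.single i 1) w + R u w| ≤ B / (n : ℝ) ^ 4) :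
    ∑ z ∈ annulus 4 0 n, (supNorm z : ℝ) ^ 2
        * |∑' q : (Pt × Pt) × (Pt × Pt), c₀ q.1 * c₁ q.2 * (F (z + q.2.2 - q.1.1) * R q.1.2 (z + q.2.1))|
      ≤ 80 * ((256 * A₂ + 256 * A₁ + 1297040 * A₀) * B)
        * ((C₀ * (768 * Real.exp (δ / 2) * (2 / δ) ^ 4 * Real.exp (δ / 2) * Zl 4 (δ / 2) ^ 2))
          * (C₁ * (768 * Real.exp (δ / 2) * (2 / δ) ^ 4 * Real.exp (δ / 2) * Zl 4 (δ / 2) ^ 2))) := by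
  have h := sum_annulus_sq_mul_abs_cross_le' hδ hc₀ hc₁ h0 h1 hF0 hF1 hF2 hn hR0 hR1 hR1' hR2
  have hf : (((2 + 2).factorial : ℕ) : ℝ) = 24 := by norm_num [Nat.factorial]
  rw [hf] at h
  refine h.trans (le_of_eq ?_)
  ring

end Window

end Summit.QuantumFields.BalabanUV.Beta.FP.NearRegionCrossBubble

end
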